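import Summits.CriticalPhenomena.SAWScalingLimit.Theses.SAWDefectDecoherence
import Summits.CriticalPhenomena.SAWScalingLimit.Theorems.SAWDefectDecoherenceBoundaryWindingRigidityCycles
import HarnessLib

/-!
# Boundary winding rigidity (discrete Umlaufsatz) for self-avoiding walks of a simply connected
hexagonal domain

Route `SAWDefectDecoherence`, support item `BoundaryWindingRigidity` (stmt-CriticalPhenomena-8515):
for a simply connected hexagonal-lattice domain `Ω` (vertex set `Λ`, "connected complement") and
two boundary mid-edges `a, b ∈ ∂Ω`, all self-avoiding walks `γ ⊂ Ω : a → b` have the same winding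
`W_γ(a, b)` (Duminil-Copin–Smirnov 2012, §4: "the winding of an interface leading to a boundary
edge `z` is uniquely determined"; Smirnov ICM 2010).

## Proof

Write `a = {u_a, v_a}`, `b = {u_b, v_b}` with `v_a, v_b ∈ Λ`, `u_a, u_b ∉ Λ`, and transport to the
coordinate model `HV` by a chart `Φ` (a similarity of the embedded lattices) with
`Φ u_a = wOut`, `Φ v_a = hvOrigin` (`HV.exists_chart`). Simple connectivity gives ONE simple
lattice path `E : Φ u_b → ⋯ → Φ u_a` avoiding `Φ(Λ)`; for every walk `γ` the list
`C(γ) = Φ(γ.verts) ++ E` is a simple cycle of `ℍ` through the entrance dart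
`(wOut, hvOrigin)` (`isCyc_code_append`). Then:

* `W_γ(a,b) = (π/3) · pturn (wOut :: Φ(γ.verts) ++ [Φ u_b])` (half-edges do not turn, the chart
  preserves turning angles, lattice turns are `±π/3`), and `cturn C(γ)` is this turn sum plus the
  turn sum along `E`, which does not depend on `γ` (`HV.cturn_split`; `winding_eq_cturn_sub`);
* `cturn C(γ) = ±6` by the tree's discrete Umlaufsatz `HV.good_or_good_reverse`, the sign being
  `+` iff the face `(1, 0)` to the right of the entrance dart has winding number `0` (else `-1`)
  (`cturn_and_wnd_entrance` of the first file);
* the winding number of `C(γ)` around `(1, 0)` is the sum over the darts of `Φ(γ.verts)` plus a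
  `γ`-independent remainder (`wnd_code_append`), and the dart sum is the same for two walks
  `γ, γ'`: their difference is the winding number around `(1, 0)` of the CLOSED lattice walk
  `Φ(γ.verts) · Φ(γ'.verts)⁻¹ ⊂ Φ(Λ)`, which vanishes because `u_a` is joined to a far vertex by a
  lattice path avoiding `Λ` along which the winding number is constant
  (`dwnd_pdarts_eq_of_endpoints`, `wnd_eq_zero_of_simplyConnected'` of the first file).

Hence `cturn C(γ) = cturn C(γ')` and `W_γ = W_{γ'}`. Degenerate cases (`a = b`, or
`v_a = v_b`) have a single walk.
-/

noncomputable section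

open Finset Literature.Probability.LatticeModels Literature.Probability.Percolation
open Literature.Probability.RandomPlanarGeometry.SAW
open Literature.Probability.RandomPlanarGeometry.SAW.HV

namespace Summit.CriticalPhenomena.SAWScalingLimit.Theorems.BoundaryWindingRigidity

/-! ### The cycle of a walk closed up through the complement -/

section Walk

variable {Λ : Finset HexVertex} {ua va ub vb : HexVertex} {Φ : hexGraph ≃g hvGraph} {α β : ℂ}
  {E : List HV}

/-- A walk from the boundary mid-edge `{u_a, v_a}` (`u_a ∉ Λ`) starts at `v_a`. [folklore] -/
theorem verts_head (δ : HexMidEdgeSAW Λ s(ua, va) s(ub, vb)) (hua : ua ∉ Λ)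
    (hne : δ.verts ≠ []) : δ.verts.head hne = va :=
  δ.head_eq rfl hua hne

/-- A walk to the boundary mid-edge `{u_b, v_b}` (`u_b ∉ Λ`) ends at `v_b`. [folklore] -/
theorem verts_getLast (δ : HexMidEdgeSAW Λ s(ua, va) s(ub, vb)) (hub : ub ∉ Λ)
    (hne : δ.verts ≠ []) : δ.verts.getLast hne = vb := by
  rcases δ.getLast_eq_or hne with h | h
  · exact absurd (by rw [← h]; exact δ.subset _ (List.getLast_mem hne)) hub
  · exact h

/-- If the two boundary mid-edges share their inner vertex, the walk visits only that vertex.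
[folklore] -/
theorem verts_eq_singleton (δ : HexMidEdgeSAW Λ s(ua, va) s(ub, vb)) (hua : ua ∉ Λ)
    (hub : ub ∉ Λ) (hne : δ.verts ≠ []) (hv : va = vb) : δ.verts = [va] := by
  have h1 := length_eq_one_of_head_eq_getLast hne δ.nodup
    (by rw [verts_head δ hua hne, verts_getLast δ hub hne, hv])
  obtain ⟨x, hx⟩ := List.length_eq_one_iff.1 h1
  have hh := verts_head δ hua hne
  simp only [hx, List.head_cons] at hh
  rw [hx, hh]

/-- If the inner vertices of the two boundary mid-edges differ, the walk visits at least two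
vertices. [folklore] -/
theorem two_le_length (δ : HexMidEdgeSAW Λ s(ua, va) s(ub, vb)) (hua : ua ∉ Λ) (hub : ub ∉ Λ)
    (hne : δ.verts ≠ []) (hv : va ≠ vb) : 2 ≤ δ.verts.length := by
  by_contra hlt
  have h1 : δ.verts.length = 1 := by
    have := List.length_pos_of_ne_nil hne; omega
  obtain ⟨x, hx⟩ := List.length_eq_one_iff.1 h1
  have hh := verts_head δ hua hne
  have hl := verts_getLast δ hub hne
  simp only [hx, List.head_cons, List.getLast_singleton] at hh hl
  exact hv (hh.symm.trans hl)

/-- The code `Φ(verts)` of a walk is a lattice path of the coordinate model. [folklore] -/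
theorem code_isChain (δ : HexMidEdgeSAW Λ s(ua, va) s(ub, vb)) :
    (δ.verts.map Φ).IsChain hvGraph.Adj := by
  rw [List.isChain_map]
  exact List.IsChain.imp (fun x y h => (Φ.map_rel_iff).2 h) δ.isChain

/-- The code of a walk lies in `Φ(Λ)`. [folklore] -/
theorem code_mem (δ : HexMidEdgeSAW Λ s(ua, va) s(ub, vb)) :
    ∀ x ∈ δ.verts.map Φ, x ∈ Λ.map Φ.toEquiv.toEmbedding := by
  intro x hx
  obtain ⟨y, hy, rfl⟩ := List.mem_map.1 hx
  exact Finset.mem_map.2 ⟨y, δ.subset y hy, rfl⟩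

/-- The code of a nontrivial walk is nonempty. [folklore] -/
theorem code_ne_nil (δ : HexMidEdgeSAW Λ s(ua, va) s(ub, vb)) (hne : δ.verts ≠ []) :
    δ.verts.map Φ ≠ [] := by
  simpa using hne

/-- The code of a walk from `{u_a, v_a}` starts at `Φ v_a = hvOrigin`. [folklore] -/
theorem code_head (δ : HexMidEdgeSAW Λ s(ua, va) s(ub, vb)) (hua : ua ∉ Λ)
    (hΦw : Φ va = hvOrigin) (hne : δ.verts ≠ []) : ∀ h, (δ.verts.map Φ).head h = hvOrigin := by
  intro h
  rw [List.head_map, verts_head δ hua hne, hΦw]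

/-- The code of a walk to `{u_b, v_b}` ends at `Φ v_b`. [folklore] -/
theorem code_getLast (δ : HexMidEdgeSAW Λ s(ua, va) s(ub, vb)) (hub : ub ∉ Λ)
    (hne : δ.verts ≠ []) : ∀ h, (δ.verts.map Φ).getLast h = Φ vb := by
  intro h
  rw [List.getLast_map h, verts_getLast δ hub hne]

/-- **The closed-up cycle** `C(γ) = Φ(γ.verts) ++ E`, for a lattice path `E` of `Φ(Λᶜ)` from
`Φ u_b` to `Φ u_a = wOut`, is a simple cycle of `ℍ`. [folklore] -/
theorem isCyc_code_append (δ : HexMidEdgeSAW Λ s(ua, va) s(ub, vb)) (hua : ua ∉ Λ) (hub : ub ∉ Λ)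
    (hΦw : Φ va = hvOrigin) (hvb : hexGraph.Adj ub vb) (hne : δ.verts ≠ [])
    (h2 : 2 ≤ δ.verts.length) (hEne : E ≠ []) (hEc : E.IsChain hvGraph.Adj) (hEnd : E.Nodup)
    (hEV : ∀ x ∈ E, x ∉ Λ.map Φ.toEquiv.toEmbedding)
    (hEhead : ∀ h, E.head h = Φ ub) (hElast : ∀ h, E.getLast h = wOut) :
    IsCyc (δ.verts.map Φ ++ E) := by
  refine ⟨?_, ?_, ?_⟩
  · simp only [List.length_append, List.length_map]
    have := List.length_pos_of_ne_nil hEne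
    omega
  · exact (δ.nodup.map Φ.injective).append hEnd (fun x hxA hxE => hEV x hxE (code_mem δ x hxA))
  · intro d hd
    rw [cdarts_append _ _ (code_ne_nil δ hne) hEne, code_getLast δ hub hne, code_head δ hua hΦw hne,
      hEhead, hElast] at hd
    simp only [List.mem_append, List.mem_cons, List.not_mem_nil, or_false] at hd
    rcases hd with (hd | rfl | hd) | rfl
    · exact adj_of_mem_pdarts (code_isChain δ) d hd
    · exact (Φ.map_rel_iff).2 hvb.symm
    · exact adj_of_mem_pdarts hEc d hd
    · exact adj_wOut_hvOrigin

/-- The closed-up cycle passes through the entrance dart `wOut → hvOrigin`. [folklore] -/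
theorem mem_cdarts_code_append (δ : HexMidEdgeSAW Λ s(ua, va) s(ub, vb)) (hua : ua ∉ Λ)
    (hΦw : Φ va = hvOrigin) (hne : δ.verts ≠ []) (hEne : E ≠ [])
    (hElast : ∀ h, E.getLast h = wOut) :
    (wOut, hvOrigin) ∈ cdarts (δ.verts.map Φ ++ E) := by
  rw [cdarts_append _ _ (code_ne_nil δ hne) hEne, code_head δ hua hΦw hne, hElast]
  simp

/-- The winding number of the closed-up cycle: the dart sum along the code plus a remainder
independent of the walk. [folklore] -/
theorem wnd_code_append (δ : HexMidEdgeSAW Λ s(ua, va) s(ub, vb)) (hua : ua ∉ Λ) (hub : ub ∉ Λ)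
    (hΦw : Φ va = hvOrigin) (hne : δ.verts ≠ []) (hEne : E ≠ [])
    (hEhead : ∀ h, E.head h = Φ ub) (hElast : ∀ h, E.getLast h = wOut) (F : ℤ × ℤ) :
    wnd (δ.verts.map Φ ++ E) F = dwnd (pdarts (δ.verts.map Φ)) F +
      (dartWnd (Φ vb, Φ ub) F + dwnd (pdarts E) F + dartWnd (wOut, hvOrigin) F) := by
  rw [wnd_eq_dwnd, cdarts_append _ _ (code_ne_nil δ hne) hEne, code_getLast δ hub hne,
    code_head δ hua hΦw hne, hEhead, hElast]
  simp only [dwnd_append, dwnd_cons, dwnd_nil]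
  ring

/-- **The winding of a walk in terms of the turning number of its closed-up cycle**:
`W_γ(a,b) = (π/3)(cturn C(γ) − K)` with `K` the turn sum along the closing path, independent of
the walk. [cite: DuminilCopinSmirnov2012, §2 (winding)] -/
theorem winding_eq_cturn_sub (δ : HexMidEdgeSAW Λ s(ua, va) s(ub, vb)) (hua : ua ∉ Λ)
    (hub : ub ∉ Λ) (hΦu : Φ ua = wOut) (hΦw : Φ va = hvOrigin) (hvb : hexGraph.Adj ub vb)
    (haff : ∀ f, emb (pos (Φ f)) = α * hexCenter f + β) (hα : α ≠ 0) (hne : δ.verts ≠ [])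
    (h2 : 2 ≤ δ.verts.length) (hEne : E ≠ []) (hEhead : ∀ h, E.head h = Φ ub)
    (hElast : ∀ h, E.getLast h = wOut) :
    δ.winding = (Real.pi / 3) *
      (cturn (δ.verts.map Φ ++ E) - pturn (Φ vb :: (E ++ [hvOrigin]))) := by
  have hl := verts_getLast δ hub hne
  have hW := winding_eq_pturn_code (Φ := Φ) δ rfl hua hΦu hΦw hvb haff hα hne (e := ub)
    (Or.inr ⟨hl, rfl⟩)
  have hs := cturn_split (δ.verts.map Φ) E (by simpa using h2) hEne
  rw [hElast, hEhead, code_getLast δ hub hne, code_head δ hua hΦw hne] at hs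
  simp only [List.cons_append] at hs
  have hs' : (pturn (wOut :: (List.map (⇑Φ) δ.verts ++ [Φ ub])) : ℝ) =
      cturn (δ.verts.map Φ ++ E) - pturn (Φ vb :: (E ++ [hvOrigin])) := by
    have := congrArg (fun z : ℤ => (z : ℝ)) hs
    push_cast at this ⊢
    linarith
  rw [hW, hs']

end Walk

end Summit.CriticalPhenomena.SAWScalingLimit.Theorems.BoundaryWindingRigidity

/-! ### The theorem -/

namespace Summit.CriticalPhenomena.SAWScalingLimit.Theorems

open BoundaryWindingRigidity

/-- **Boundary winding rigidity (discrete Umlaufsatz), route item `BoundaryWindingRigidity`**: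
for a simply connected hexagonal-lattice domain with vertex set `Λ` and boundary mid-edges
`a, b ∈ ∂Ω`, all self-avoiding walks `a → b` in `Ω` have the same winding ("the winding of an
interface leading to a boundary edge is uniquely determined"). Proof: close every walk by one
fixed lattice path of the complement; the resulting simple cycles have turning number `±2π`
(Umlaufsatz) with a common sign, read off from the winding number at the entrance face, which
only depends on the walk through a closed walk of `Φ(Λ)` not surrounding the entrance.
[cite: DuminilCopinSmirnov2012, §4] -/
theorem boundaryWindingRigidity_proof :
    Summit.CriticalPhenomena.SAWScalingLimit.Theses.SAWDefectDecoherence.BoundaryWindingRigidity := by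
  intro Λ hΛ a ha b hb γ γ'
  classical
  by_cases hab : a = b
  · subst hab
    have h1 := HexMidEdgeSAW.verts_eq_nil_of_mem_boundary ha γ
    have h2 := HexMidEdgeSAW.verts_eq_nil_of_mem_boundary ha γ'
    rw [HexMidEdgeSAW.ext (h1.trans h2.symm)]
  by_cases hvv : γ.verts = γ'.verts
  · rw [HexMidEdgeSAW.ext hvv]
  obtain ⟨haE, ua, va, rfl, hva, hua⟩ := ha
  obtain ⟨hbE, ub, vb, rfl, hvb, hub⟩ := hb
  have hAdja : hexGraph.Adj ua va := (SimpleGraph.mem_edgeSet hexGraph).1 haE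
  have hAdjb : hexGraph.Adj ub vb := (SimpleGraph.mem_edgeSet hexGraph).1 hbE
  have hne : γ.verts ≠ [] := fun h => hab (γ.eq_of_nil h)
  have hne' : γ'.verts ≠ [] := fun h => hab (γ'.eq_of_nil h)
  -- the inner vertices differ (else both walks are the one-vertex walk)
  have hv : va ≠ vb := fun hv =>
    hvv ((verts_eq_singleton γ hua hub hne hv).trans (verts_eq_singleton γ' hua hub hne' hv).symm)
  have h2 := two_le_length γ hua hub hne hv
  have h2' := two_le_length γ' hua hub hne' hv
  -- the chart at the entrance dart
  obtain ⟨Φ, α, β, hα, hΦu, hΦw, haff⟩ := exists_chart hAdja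
  -- the closing path `E : Φ u_b → ⋯ → Φ u_a` in the complement
  obtain ⟨W⟩ := hΛ ⟨ub, by simpa using hub⟩ ⟨ua, by simpa using hua⟩
  have hEc : (W.bypass.support.map fun x => Φ x.1).IsChain hvGraph.Adj := by
    rw [List.isChain_map]
    exact List.IsChain.imp (fun x y h => (Φ.map_rel_iff).2 h) W.bypass.isChain_adj_support
  have hEV : ∀ x ∈ (W.bypass.support.map fun x => Φ x.1), x ∉ Λ.map Φ.toEquiv.toEmbedding := by
    intro x hx hxV
    obtain ⟨z, -, rfl⟩ := List.mem_map.1 hx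
    obtain ⟨z', hz', hzz⟩ := Finset.mem_map.1 hxV
    change Φ z' = Φ z.1 at hzz
    exact z.2 (Φ.injective hzz ▸ hz')
  have hinj : Function.Injective (fun x : ↥((↑Λ : Set HexVertex)ᶜ) => Φ x.1) :=
    fun x y h => Subtype.ext (Φ.injective h)
  have hEnd : (W.bypass.support.map fun x => Φ x.1).Nodup :=
    (W.bypass_isPath.support_nodup).map hinj
  have hEne : (W.bypass.support.map fun x => Φ x.1) ≠ [] := by simp
  have hEhead : ∀ h, (W.bypass.support.map fun x => Φ x.1).head h = Φ ub := by
    intro h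
    rw [List.head_map]
    simp
  have hElast : ∀ h, (W.bypass.support.map fun x => Φ x.1).getLast h = wOut := by
    intro h
    rw [List.getLast_map h, ← hΦu]
    simp
  -- the winding numbers of the two closed-up cycles at the entrance face agree
  have hw : wnd (γ.verts.map Φ ++ (W.bypass.support.map fun x => Φ x.1)) (1, 0) =
      wnd (γ'.verts.map Φ ++ (W.bypass.support.map fun x => Φ x.1)) (1, 0) := by
    rw [wnd_code_append γ hua hub hΦw hne hEne hEhead hElast,
      wnd_code_append γ' hua hub hΦw hne' hEne hEhead hElast,
      dwnd_pdarts_eq_of_endpoints hΛ hua hΦu (code_isChain γ) (code_isChain γ') (code_mem γ)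
        (code_mem γ') (by simpa using h2) (by simpa using h2') ?_ ?_]
    · rw [List.head?_eq_some_head (code_ne_nil γ hne), List.head?_eq_some_head (code_ne_nil γ' hne'),
        code_head γ hua hΦw hne, code_head γ' hua hΦw hne']
    · rw [List.getLast?_eq_some_getLast (code_ne_nil γ hne),
        List.getLast?_eq_some_getLast (code_ne_nil γ' hne'), code_getLast γ hub hne,
        code_getLast γ' hub hne']
  -- hence so do their turning numbers, and the windings
  have hct := cturn_eq_of_wnd_entrance_eq
    (isCyc_code_append γ hua hub hΦw hAdjb hne h2 hEne hEc hEnd hEV hEhead hElast)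
    (isCyc_code_append γ' hua hub hΦw hAdjb hne' h2' hEne hEc hEnd hEV hEhead hElast)
    (mem_cdarts_code_append γ hua hΦw hne hEne hElast)
    (mem_cdarts_code_append γ' hua hΦw hne' hEne hElast) hw
  rw [winding_eq_cturn_sub γ hua hub hΦu hΦw hAdjb haff hα hne h2 hEne hEhead hElast,
    winding_eq_cturn_sub γ' hua hub hΦu hΦw hAdjb haff hα hne' h2' hEne hEhead hElast, hct]

end Summit.CriticalPhenomena.SAWScalingLimit.Theorems
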